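import Summits.QuantumAdvantage.QuantumAdvantage.Theorems.StabilizerDialAntipodalC

/-! # StabilizerDialAntipodalD — part 4/5 (mechanical split for landing of `StabilizerDialAntipodal`; content verbatim; scopes re-opened with their variables) -/

set_option linter.dupNamespace false
noncomputable section
open scoped Classical

namespace Summit.QuantumAdvantage.QuantumAdvantage.Theorems.StabilizerDial
open Finset
open Literature.Computability.QuantumComplexity Literature.Computability.QuantumComplexity.RingHLF
open Literature.Computability.MetaComplexity Literature.Computability.MetaComplexity.Smolensky
open Summit.QuantumAdvantage.AdviceFreeQNC0
open Summit.QuantumAdvantage.QuantumAdvantage.Theorems.HolonomyDial (selP selP_mem selP_apply xorP xorP_mem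
  xorP_apply_bool tPoly tPoly_mem tPoly_apply mono_singleton_apply card_odd_le)
open Summit.QuantumAdvantage.QuantumAdvantage.Theorems.AnchorDial (outB dev card_odd_ge)
open Summit.QuantumAdvantage.QuantumAdvantage.Theorems.LocusDial (Coverable FewLocus)
variable {N : ℕ}

/-! ### Central binomial arithmetic, gated selectors, and the proof of S12 -/

/-- `(m-1)·C(m,⌊m/2⌋)² ≤ 4^m` (odd `m`: the tree's `choose_half_sq_mul_le`; even `m = 2i+2`: `C(2i+2,i+1) = 2·C(2i+1,i)`). -/
theorem pred_mul_choose_half_sq_le (m : ℕ) : (m - 1) * m.choose (m / 2) ^ 2 ≤ 4 ^ m := by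
  rcases Nat.even_or_odd m with ⟨i, rfl⟩ | hodd
  · cases i with
    | zero => simp
    | succ i =>
      have h2 : i + 1 + (i + 1) = 2 * i + 1 + 1 := by ring
      rw [h2]
      have hhalf : (2 * i + 1 + 1) / 2 = i + 1 := by omega
      rw [hhalf, Nat.choose_succ_succ, Nat.choose_symm_half]
      have hodd : Odd (2 * i + 1) := ⟨i, rfl⟩
      have ht := choose_half_sq_mul_le hodd
      have hh : (2 * i + 1) / 2 = i := by omega
      rw [hh] at ht
      have : 2 * i + 1 + 1 - 1 = 2 * i + 1 := by omega
      rw [this]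
      calc (2 * i + 1) * ((2 * i + 1).choose i + (2 * i + 1).choose i) ^ 2
          = 4 * ((2 * i + 1).choose i ^ 2 * (2 * i + 1)) := by ring
        _ ≤ 4 * 4 ^ (2 * i + 1) := Nat.mul_le_mul_left _ ht
        _ = 4 ^ (2 * i + 1 + 1) := by rw [pow_succ]; ring
  · calc (m - 1) * m.choose (m / 2) ^ 2 ≤ m * m.choose (m / 2) ^ 2 := Nat.mul_le_mul_right _ (Nat.sub_le _ _)
      _ = m.choose (m / 2) ^ 2 * m := by ring
      _ ≤ 4 ^ m := choose_half_sq_mul_le hodd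

/-- `K·M·C(m,⌊m/2⌋) ≤ 2^m` once `K²M² + 1 ≤ m`. -/
theorem mul_choose_half_le (K M m : ℕ) (hM : K * K * M ^ 2 + 1 ≤ m) : K * M * m.choose (m / 2) ≤ 2 ^ m := by
  have h := pred_mul_choose_half_sq_le m
  have h4 : (4 : ℕ) ^ m = 2 ^ m * 2 ^ m := by rw [← mul_pow]; norm_num
  rw [← Nat.mul_self_le_mul_self_iff, ← h4]
  calc K * M * m.choose (m / 2) * (K * M * m.choose (m / 2)) = K * K * M ^ 2 * m.choose (m / 2) ^ 2 := by ring
    _ ≤ (m - 1) * m.choose (m / 2) ^ 2 := Nat.mul_le_mul_right _ (by omega)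
    _ ≤ 4 ^ m := h

/-- gated selector: `selP f` if `b`, else `0`. -/
def gateP (b : Bool) (f : CubeFn (ZMod 3) N) : CubeFn (ZMod 3) N := if b then selP f else 0

/-- StabilizerDialAntipodal helper `gateP_mem` (antipodal certificate; see the module docstring). -/
theorem gateP_mem (b : Bool) {D : ℕ} {f : CubeFn (ZMod 3) N} (hf : f ∈ lowDeg (ZMod 3) N D) :
    gateP b f ∈ lowDeg (ZMod 3) N (D + D) := by
  unfold gateP; cases b
  · simp only [Bool.false_eq_true, if_false]; exact Submodule.zero_mem _
  · simp only [if_true]; exact selP_mem hf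

/-- StabilizerDialAntipodal helper `gateP_apply` (antipodal certificate; see the module docstring). -/
theorem gateP_apply (b : Bool) (f : CubeFn (ZMod 3) N) (x : Fin N → Bool) :
    gateP b f x = if (b && bitP f x) then 1 else 0 := by
  unfold gateP bitP; cases b
  · simp
  · simp only [if_true, Bool.true_and]
    rw [selP_apply]
    by_cases h : f x = 1 <;> simp [h]

/-- **S12 (good-set bound) — PROVED.**  Fibre over the `N - k` coordinates outside the antipodal block `F = B + ⌊N/2⌋`: on a fibre
the block bits are frozen, `OddZeros` is a parity slice of the `k` free bits, and the block recurrence makes the degree-`≤ 8d+1`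
polynomial `Q = ⊕ᵢ [cᵢ] selP (s ∂ᵢ)` agree with `par_T`; `oddSliceBound_holds` + `(m-1)C(m,m/2)² ≤ 4^m` + `k ≥ 3456·(8d+1)²` give `8·# ≤ 3·2^k`. -/
theorem goodBound_of_blockRec (N e a k : ℕ) (s : Fin N → CubeFn (ZMod 3) N) (hs : ∀ i, s i ∈ lowDeg (ZMod 3) N ((Nat.log 2 N) ^ e))
    (hk : 3456 * (8 * (Nat.log 2 N) ^ e + 1) ^ 2 ≤ k) (ha : 1 ≤ a) (hak : a + k + 1 ≤ N / 2)
    (FI : FibreIdentityAt N a k) (OS : OddSliceBound N) :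
    8 * (univ.filter fun x : Fin N → Bool => OddZeros x ∧ BlockRec s a k x).card ≤ 3 * 2 ^ N := by
  obtain ⟨c, T, hloc, hT, hid⟩ := FI
  set d := (Nat.log 2 N) ^ e with hd
  have hX : 1 ≤ (8 * d + 1) ^ 2 := Nat.one_le_pow _ _ (by omega)
  have hN : 0 < N := by omega
  have hkN : a + k + N / 2 < N := by omega
  -- the antipodal block `F`
  set F : Finset (Fin N) := univ.filter fun i : Fin N => a + N / 2 ≤ i.val ∧ i.val < a + k + N / 2 with hF
  have hmemF : ∀ i : Fin N, i ∈ F ↔ a + N / 2 ≤ i.val ∧ i.val < a + k + N / 2 := fun i => by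
    rw [hF, mem_filter]; simp
  have hFcard : F.card = k := by
    symm
    rw [← Finset.card_range k]
    refine Finset.card_bij' (fun t ht => (⟨a + N / 2 + t, by have := Finset.mem_range.1 ht; omega⟩ : Fin N))
      (fun i _ => i.val - (a + N / 2)) ?_ ?_ ?_ ?_
    · intro t ht; have := Finset.mem_range.1 ht; rw [hmemF]; simp only; omega
    · intro i hi; rw [hmemF] at hi; rw [Finset.mem_range]; omega
    · intro t ht; show a + N / 2 + t - (a + N / 2) = t; omega
    · intro i hi; rw [hmemF] at hi; apply Fin.ext; show a + N / 2 + (i.val - (a + N / 2)) = i.val; omega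
  -- fibre decomposition over the coordinates outside `F`
  set Z : Finset (Fin N → Bool) := univ.filter fun z => ∀ i ∈ F, z i = false with hZ
  have hZcard : Z.card = 2 ^ (N - k) := by rw [← hFcard]; exact card_subcube F (fun _ => false)
  set proj : (Fin N → Bool) → (Fin N → Bool) := fun x i => if i ∈ F then false else x i with hproj
  have hprojZ : ∀ x, proj x ∈ Z := fun x => by
    rw [hZ, mem_filter]; refine ⟨mem_univ _, fun i hi => ?_⟩; rw [hproj]; simp only; rw [if_pos hi]
  set Good := univ.filter fun x : Fin N → Bool => OddZeros x ∧ BlockRec s a k x with hGood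
  rw [Finset.card_eq_sum_card_fiberwise (f := proj) (s := Good) (t := Z) (fun x _ => hprojZ x), Finset.mul_sum]
  -- boundary positions and the per-fibre bound
  have h0N : a - 1 < N := by omega
  have h1N : a < N := by omega
  have h2N : a + k - 1 < N := by omega
  have h3N : a + k < N := by omega
  have hper : ∀ z ∈ Z, 8 * (Good.filter fun x => proj x = z).card ≤ 3 * 2 ^ k := by
    intro z hz
    rw [hZ, mem_filter] at hz
    have hTF : T z ⊆ F := fun i hi => (hmemF i).2 ((hT z).1 i hi)
    have hsum : (F \ T z).card + (T z).card = k := by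
      have := Finset.card_sdiff_add_card_eq_card hTF; rwa [hFcard] at this
    have hunion : T z ∪ (F \ T z) = F := Finset.union_sdiff_of_subset hTF
    -- the gated boundary polynomial
    set Qz : CubeFn (ZMod 3) N :=
      xorP (xorP (gateP (c z 0) (s ⟨a - 1, h0N⟩)) (gateP (c z 1) (s ⟨a, h1N⟩)))
        (xorP (gateP (c z 2) (s ⟨a + k - 1, h2N⟩)) (gateP (c z 3) (s ⟨a + k, h3N⟩))) with hQz
    have hQmem : Qz ∈ lowDeg (ZMod 3) N (8 * d + 1) := by
      have h8 := xorP_mem (xorP_mem (gateP_mem (c z 0) (hs ⟨a - 1, h0N⟩)) (gateP_mem (c z 1) (hs ⟨a, h1N⟩)))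
        (xorP_mem (gateP_mem (c z 2) (hs ⟨a + k - 1, h2N⟩)) (gateP_mem (c z 3) (hs ⟨a + k, h3N⟩)))
      exact lowDeg_mono (by omega) h8
    have hQval : ∀ x : Fin N → Bool, Qz x =
        if xor (xor (c z 0 && bitP (s ⟨a - 1, h0N⟩) x) (c z 1 && bitP (s ⟨a, h1N⟩) x))
            (xor (c z 2 && bitP (s ⟨a + k - 1, h2N⟩) x) (c z 3 && bitP (s ⟨a + k, h3N⟩) x)) then 1 else 0 := fun x => by
      rw [hQz]
      exact xorP_apply_bool _ _ x _ _ (xorP_apply_bool _ _ x _ _ (gateP_apply _ _ x) (gateP_apply _ _ x))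
        (xorP_apply_bool _ _ x _ _ (gateP_apply _ _ x) (gateP_apply _ _ x))
    -- the target parity of the free bits
    set cz : Bool := decide ((k + (univ.filter fun i : Fin N => i ∉ F ∧ z i = false).card + 1) % 2 = 1) with hcz
    -- Good ∩ fibre ⊆ odd-slice set
    have hsub : (Good.filter fun x => proj x = z) ⊆ univ.filter fun x : Fin N → Bool =>
        (∀ i, i ∉ T z → i ∉ F \ T z → x i = z i) ∧ parB (T z ∪ (F \ T z)) x = cz ∧
          Qz x = if parB (T z) x then 1 else 0 := by
      intro x hx
      rw [hGood, Finset.mem_filter, Finset.mem_filter] at hx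
      obtain ⟨⟨-, hodd, hrec⟩, hpx⟩ := hx
      have hoff : ∀ i, i ∉ F → x i = z i := fun i hi => by
        have := congrFun hpx i; rw [hproj] at this; simp only at this; rwa [if_neg hi] at this
      rw [Finset.mem_filter]
      refine ⟨mem_univ _, fun i hi1 hi2 => hoff i (fun hiF => hi2 (Finset.mem_sdiff.2 ⟨hiF, hi1⟩)), ?_, ?_⟩
      · -- `OddZeros` is the parity slice `parB F x = cz`
        rw [hunion]
        have hodd' : (univ.filter fun b : Fin N => x b = false).card % 2 = 1 := by
          have h := hodd; unfold OddZeros at h; convert h using 5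
        have hsplit := Finset.card_filter_add_card_filter_not
          (s := univ.filter fun b : Fin N => x b = false) (fun b => b ∈ F)
        rw [Finset.filter_filter, Finset.filter_filter] at hsplit
        have hin : (univ.filter fun b : Fin N => x b = false ∧ b ∈ F) = F.filter fun b => x b = false := by
          ext b; simp only [mem_filter, mem_univ, true_and]; tauto
        have hout : (univ.filter fun b : Fin N => x b = false ∧ ¬ b ∈ F) =
            univ.filter fun i : Fin N => i ∉ F ∧ z i = false := by
          ext b; simp only [mem_filter, mem_univ, true_and]
          constructor
          · rintro ⟨hb1, hb2⟩; exact ⟨hb2, by rw [← hoff b hb2]; exact hb1⟩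
          · rintro ⟨hb1, hb2⟩; exact ⟨by rw [hoff b hb1]; exact hb2, hb1⟩
        rw [hin, hout] at hsplit
        have hF2 := Finset.card_filter_add_card_filter_not (s := F) (fun b => x b = false)
        have hneg : (F.filter fun b => ¬ x b = false) = F.filter fun b => x b = true :=
          Finset.filter_congr fun b _ => by simp
        rw [hneg, hFcard] at hF2
        rw [hcz]; unfold parB
        rw [decide_eq_decide]
        omega
      · -- the block recurrence turns the fibre identity into `Qz x = ι(parB (T z) x)`
        have hagree : ∀ j : Fin N, a ≤ j.val → j.val < a + k → x j = z j := fun j hj1 hj2 =>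
          hoff j fun hjF => by have := (hmemF j).1 hjF; omega
        obtain ⟨hc, hTx⟩ := hloc x z hagree
        have hidx := hid x (bits s x) h0N h1N h2N h3N (fun j hj1 hj2 => hrec j hj1 hj2)
        rw [hQval x, ← hc, ← hTx, ← hidx]
        rfl
    -- odd-slice bound on the fibre
    have hOS := OS (8 * d + 1) (by omega) (T z) (F \ T z) Finset.disjoint_sdiff Qz hQmem z cz
    have hcnt := le_trans (Finset.card_le_card hsub) hOS
    obtain ⟨m₁, hm1⟩ : ∃ m, (T z).card = m := ⟨_, rfl⟩
    obtain ⟨m₂, hm2⟩ : ∃ m, (F \ T z).card = m := ⟨_, rfl⟩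
    rw [hm1, hm2] at hcnt
    rw [hm1, hm2] at hsum
    have hm₁k : k ≤ 3 * m₁ ∧ 3 * m₁ ≤ 2 * k := by rw [← hm1]; exact ⟨(hT z).2.1, (hT z).2.2⟩
    -- arithmetic
    have b1 : 16 * (8 * d + 1) * m₁.choose (m₁ / 2) ≤ 2 ^ m₁ := mul_choose_half_le 16 (8 * d + 1) m₁ (by omega)
    have b2 : 32 * (8 * d + 1) * m₂.choose (m₂ / 2) ≤ 2 ^ m₂ := mul_choose_half_le 32 (8 * d + 1) m₂ (by omega)
    have hpk : 2 ^ m₁ * 2 ^ m₂ = 2 ^ k := by rw [← pow_add]; congr 1; omega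
    have b1' : 16 * (8 * d + 1) * m₁.choose (m₁ / 2) * 2 ^ m₂ ≤ 2 ^ k := by
      calc 16 * (8 * d + 1) * m₁.choose (m₁ / 2) * 2 ^ m₂ ≤ 2 ^ m₁ * 2 ^ m₂ := Nat.mul_le_mul_right _ b1
        _ = 2 ^ k := hpk
    have b2' : 32 * (8 * d + 1) * m₂.choose (m₂ / 2) * 2 ^ m₁ ≤ 2 ^ k := by
      calc 32 * (8 * d + 1) * m₂.choose (m₂ / 2) * 2 ^ m₁ ≤ 2 ^ m₂ * 2 ^ m₁ := Nat.mul_le_mul_right _ b2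
        _ = 2 ^ k := by rw [mul_comm]; exact hpk
    have ek : m₁ + m₂ - 2 + 2 = k := by omega
    have e0 : 8 * 2 ^ (m₁ + m₂ - 2) = 2 * 2 ^ k := by
      calc 8 * 2 ^ (m₁ + m₂ - 2) = 2 * (2 ^ (m₁ + m₂ - 2) * 2 ^ 2) := by ring
        _ = 2 * 2 ^ k := by rw [← pow_add, ek]
    have h2 : 2 * (8 * (Good.filter fun x => proj x = z).card) ≤ 6 * 2 ^ k := by
      calc 2 * (8 * (Good.filter fun x => proj x = z).card)
          ≤ 2 * (8 * (2 ^ (m₁ + m₂ - 2) + (8 * d + 1) * m₁.choose (m₁ / 2) * 2 ^ m₂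
              + 2 * (8 * d + 1) * m₂.choose (m₂ / 2) * 2 ^ m₁)) :=
            Nat.mul_le_mul_left _ (Nat.mul_le_mul_left _ hcnt)
        _ = 2 * (8 * 2 ^ (m₁ + m₂ - 2)) + 16 * (8 * d + 1) * m₁.choose (m₁ / 2) * 2 ^ m₂
              + 32 * (8 * d + 1) * m₂.choose (m₂ / 2) * 2 ^ m₁ := by ring
        _ ≤ 2 * (2 * 2 ^ k) + 2 ^ k + 2 ^ k := by rw [e0]; exact Nat.add_le_add (Nat.add_le_add le_rfl b1') b2'
        _ = 6 * 2 ^ k := by ring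
    omega
  have hkN' : k ≤ N := by omega
  calc ∑ z ∈ Z, 8 * (Good.filter fun x => proj x = z).card ≤ ∑ z ∈ Z, 3 * 2 ^ k := Finset.sum_le_sum hper
    _ = 3 * 2 ^ N := by
      rw [Finset.sum_const, smul_eq_mul, hZcard, mul_left_comm, ← pow_add, Nat.sub_add_cancel hkN']

/-- **S3 (block selection by averaging against the windows) — PROVED.**  For each few-locus input the `m` windows of width `r` meet at most
`m(k+r)` of the blocks `[a, a+k)`, `1 ≤ a ≤ N/2 − k − 1`; the non-coverable odd inputs number `≤ 2^{N-1}/log₂N`. -/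
theorem blockSelect_of_fewLocus (m r k N : ℕ) (s : Fin N → CubeFn (ZMod 3) N) (hF : FewLocus m r (pad (fun i => apStrat i) s))
    (hk : 2 * k + 4 ≤ N / 2) :
    ∃ a : ℕ, 1 ≤ a ∧ a + k + 1 ≤ N / 2 ∧
      (N / 2 - k - 1) * Nat.log 2 N * (univ.filter fun x : Fin N → Bool => OddZeros x ∧ ¬ BlockRec s a k x).card ≤
        (N / 2 - k - 1) * 2 ^ (N - 1) + Nat.log 2 N * (2 * m * (k + r)) * 2 ^ (N - 1) := by
  set α := N / 2 - k - 1 with hαdef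
  set L := Nat.log 2 N with hLdef
  have hα : 1 ≤ α := by omega
  set A : Finset ℕ := Finset.Icc 1 α with hAdef
  have hAcard : A.card = α := by rw [hAdef, Nat.card_Icc]; omega
  have hAne : A.Nonempty := ⟨1, by rw [hAdef, Finset.mem_Icc]; omega⟩
  set NC : Finset (Fin N → Bool) :=
    univ.filter fun x => OddZeros x ∧ ¬ Coverable m r (dev (pad (fun i => apStrat i) s) x) with hNCdef
  have hNC : L * NC.card ≤ 2 ^ (N - 1) := hF
  -- (1) per-input count of bad block positions
  have hper : ∀ x : Fin N → Bool,
      (A.filter fun a => OddZeros x ∧ ¬ BlockRec s a k x).card ≤ (if x ∈ NC then α else 0) + m * (k + r) := by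
    intro x
    by_cases hodd : OddZeros x
    · by_cases hcov : Coverable m r (dev (pad (fun i => apStrat i) s) x)
      · obtain ⟨kv, hkv⟩ := hcov
        have hsub : (A.filter fun a => OddZeros x ∧ ¬ BlockRec s a k x) ⊆
            (univ : Finset (Fin m)).biUnion fun t => Finset.Icc (kv t + 1 - k) (kv t + r) := by
          intro a ha
          rw [mem_filter] at ha
          obtain ⟨-, -, hBad⟩ := ha
          unfold BlockRec at hBad
          push Not at hBad
          obtain ⟨j, haj, hjk, hne⟩ := hBad
          obtain ⟨t, ht1, ht2⟩ := hkv j ((mem_dev_pad_apStrat_iff s x j).2 hne)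
          rw [mem_biUnion]
          refine ⟨t, mem_univ _, ?_⟩
          rw [Finset.mem_Icc]
          constructor <;> omega
        calc (A.filter fun a => OddZeros x ∧ ¬ BlockRec s a k x).card
            ≤ ((univ : Finset (Fin m)).biUnion fun t => Finset.Icc (kv t + 1 - k) (kv t + r)).card := card_le_card hsub
          _ ≤ ∑ t, (Finset.Icc (kv t + 1 - k) (kv t + r)).card := card_biUnion_le
          _ ≤ ∑ _t : Fin m, (k + r) := sum_le_sum fun t _ => by rw [Nat.card_Icc]; omega
          _ = m * (k + r) := by simp
          _ ≤ _ := Nat.le_add_left _ _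
      · have hx : x ∈ NC := by rw [hNCdef, mem_filter]; exact ⟨mem_univ _, hodd, hcov⟩
        rw [if_pos hx]
        calc (A.filter fun a => OddZeros x ∧ ¬ BlockRec s a k x).card ≤ A.card := card_filter_le _ _
          _ = α := hAcard
          _ ≤ α + m * (k + r) := Nat.le_add_right _ _
    · have h0 : (A.filter fun a => OddZeros x ∧ ¬ BlockRec s a k x) = ∅ := by
        rw [Finset.filter_eq_empty_iff]
        intro a _ h
        exact hodd h.1
      rw [h0, card_empty]
      exact Nat.zero_le _
  -- (2) double counting
  have hdc := Finset.sum_card_bipartiteAbove_eq_sum_card_bipartiteBelow (s := A) (t := (univ : Finset (Fin N → Bool)))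
    (r := fun a x => OddZeros x ∧ ¬ BlockRec s a k x)
  simp only [Finset.bipartiteAbove, Finset.bipartiteBelow] at hdc
  -- (3) the total
  have hcardU : (univ : Finset (Fin N → Bool)).card = 2 ^ N := by simp
  have htot : ∑ a ∈ A, (univ.filter fun x : Fin N → Bool => OddZeros x ∧ ¬ BlockRec s a k x).card ≤
      α * NC.card + 2 ^ N * (m * (k + r)) := by
    rw [hdc]
    calc ∑ x : Fin N → Bool, (A.filter fun a => OddZeros x ∧ ¬ BlockRec s a k x).card
        ≤ ∑ x : Fin N → Bool, ((if x ∈ NC then α else 0) + m * (k + r)) := sum_le_sum fun x _ => hper x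
      _ = α * NC.card + 2 ^ N * (m * (k + r)) := by
        rw [sum_add_distrib, sum_const, smul_eq_mul, hcardU, Finset.sum_ite_mem, univ_inter, sum_const, smul_eq_mul,
          Nat.mul_comm]
  -- (4) pigeonhole over the block position
  obtain ⟨a, haA, ha⟩ := Finset.exists_le_of_sum_le hAne (f := fun a =>
      α * (univ.filter fun x : Fin N → Bool => OddZeros x ∧ ¬ BlockRec s a k x).card)
    (g := fun _ => ∑ a' ∈ A, (univ.filter fun x : Fin N → Bool => OddZeros x ∧ ¬ BlockRec s a' k x).card)
    (by rw [← mul_sum, sum_const, smul_eq_mul, hAcard])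
  rw [hAdef, Finset.mem_Icc] at haA
  refine ⟨a, haA.1, by omega, ?_⟩
  have hN1 : 2 ^ N = 2 * 2 ^ (N - 1) := by
    conv_lhs => rw [show N = (N - 1) + 1 by omega]
    rw [pow_succ]; ring
  have hmain : α * (univ.filter fun x : Fin N → Bool => OddZeros x ∧ ¬ BlockRec s a k x).card ≤
      α * NC.card + 2 ^ N * (m * (k + r)) := le_trans ha htot
  calc α * L * (univ.filter fun x : Fin N → Bool => OddZeros x ∧ ¬ BlockRec s a k x).card
      = L * (α * (univ.filter fun x : Fin N → Bool => OddZeros x ∧ ¬ BlockRec s a k x).card) := by ring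
    _ ≤ L * (α * NC.card + 2 ^ N * (m * (k + r))) := Nat.mul_le_mul_left _ hmain
    _ = α * (L * NC.card) + L * (2 * m * (k + r)) * 2 ^ (N - 1) := by rw [hN1]; ring
    _ ≤ α * 2 ^ (N - 1) + L * (2 * m * (k + r)) * 2 ^ (N - 1) := Nat.add_le_add_right (Nat.mul_le_mul_left _ hNC) _


end Summit.QuantumAdvantage.QuantumAdvantage.Theorems.StabilizerDial
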